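import Summits.CriticalPhenomena.CardyFormulaZ2.Theorems.CardyComplexConeEdgePrecompactUFRSJunctionFunnelDatum
import Summits.CriticalPhenomena.CardyFormulaZ2.Theorems.CardyComplexConeEdgePrecompactUFRSJunctionFunnelColours

/-!
# The junction funnel, part I: the funnel for the datum and its translate
(line `qkz-strip-boundary-arm` of crux `CardyComplexCone.EdgePrecompact`, stmt-CriticalPhenomena-11387;
ninth file of the registered sub-goal S2 = `ufrs_junctionFunnel`, lead c5, wave 4; registered
anchor `core_funnel_JF`; continues `…UFRSJunctionFunnelDatum.lean`, `…UFRSJunctionFunnelColours.lean`)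

`core_funnel_JF` — the integer-level core of the funnel: given rectangle data `G`, a rotation
frame `ψ` centred near the junction with the physical geometry of the flat / corner reference
picture (near the origin the box is a half-plane, resp. a quadrant), the junction at the reference
position, the second marked edge far, a small translation `u` and the arch of the gate read in
the frame, every crossing orbit stretch of `G` AND of `shiftData G u` visits the same physical
corner. The reference box and its position come from `refbox_JF` and the physical geometry at a
few test points, the colours from `junction_colours_JF`, the conclusion from `datum_funnel_JF`;
for the translate everything is shifted by `σ u` (transport lemmas of
`…EdgePrecompactMedialExplorationShiftData.lean`).

References: S. Smirnov, C. R. Acad. Sci. Paris 333 (2001), §2.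
-/

set_option linter.unusedVariables false

namespace Summit.CriticalPhenomena.CardyFormulaZ2.Cruxes.EdgePrecompact.QkzStripBoundaryArm

open MeasureTheory Filter Set Metric
open scoped Topology BigOperators Pointwise
open Literature.Probability.LatticeModels Literature.Probability.Percolation
open Literature.Probability.RandomPlanarGeometry (DobrushinDomain)
open Summit.CriticalPhenomena.CardyFormulaZ2.Theses.CardyComplexCone

noncomputable section

/-! ## The funnel for the datum and its translate -/

/-- A site minus a vector, in coordinates. -/
theorem vec_sub_JF (x y : ℤ) (w : Site 2) : (![x, y] : Site 2) - w = ![x - w 0, y - w 1] := by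
  rw [Site.eq_iff_two]; simp

/-- Translating the pull-back: `ψ⁻¹ z - u = ψ⁻¹ (z - σ u)`. -/
theorem frame_symm_sub_JF (π : Equiv.Perm (Fin 2)) (ε : Fin 2 → ℤˣ) (n u z : Site 2) :
    ((zdShiftIso (-n)).trans (zdSignedPermIso π ε)).symm z - u =
      ((zdShiftIso (-n)).trans (zdSignedPermIso π ε)).symm (z - Site.signedPerm π ε u) := by
  apply ((zdShiftIso (-n)).trans (zdSignedPermIso π ε)).injective
  rw [RelIso.apply_symm_apply, frame_apply_JF, show ((zdShiftIso (-n)).trans (zdSignedPermIso π ε)).symm z - u - n =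
    (((zdShiftIso (-n)).trans (zdSignedPermIso π ε)).symm z - n) - u by abel]
  rw [show ∀ a b : Site 2, Site.signedPerm π ε (a - b) = Site.signedPerm π ε a - Site.signedPerm π ε b from
    fun a b => by rw [eq_sub_iff_add_eq, ← Site.signedPerm_add, sub_add_cancel], frame_apply_symm_JF]

/-- **The funnel for the datum `G` and its translate `shiftData G u`** (registered anchor `core_funnel_JF`
of stmt-CriticalPhenomena-11387): the integer-level core of `ufrs_junctionFunnel`. Given rectangle
data `G`, a rotation frame `ψ` centred near the junction `{nA, nB}` with the physical geometry of
the flat / corner reference picture (`hphys`: near the origin the box is the half-plane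
`{x₁ ≥ 0}`, resp. the quadrant `{x₁ ≥ 0, s x₀ ≥ 0}`), the junction at the reference position, the
second marked edge far, a small translation `u`, and the arch of the gate read in the frame, every
crossing orbit stretch of `G` AND of `shiftData G u` (inner faces of the respective datum, one end
within sup-distance `2N - 1` of the frame origin, the other beyond `4N + h + 2`) visits the same
physical corner `(ψ⁻¹ v₀, k₀ - j)`. Proof: reference box (`refbox_JF`), its position from `hphys`
at five test points, colours from `junction_colours_JF`, then `datum_funnel_JF` for `G`; for the
translate everything is shifted by `σ u` (`mem_zdArcA/B_shiftData_iff`, `mem_zdBoundary_shiftData_iff`,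
`mem_meshDomain_vadd`). -/
theorem core_funnel_JF : ∀ (G : DiscreteDobrushin) (a₀ a₁ b₀ b₁ : ℝ), G.IsZdAdmissible → G.Ω = Set.Ioo a₀ a₁ ×ℂ Set.Ioo b₀ b₁ → ∀ (π : Equiv.Perm (Fin 2)) (ε : Fin 2 → ℤˣ) (j : Fin 4) (n : Site 2), (∀ k, Site.signedPerm π ε (cornerUnit k) = cornerUnit (k + j)) → ∀ (N h : ℕ) (s : ℤ) (corner onA : Bool) (t₀ Lp : ℤ) (nA nB u : Site 2) (eF : Sym2 (Site 2)), 2 * h + 2 ≤ N → 1 ≤ h → (s = 1 ∨ s = -1) → 4 * (N : ℤ) + 2 * h + 4 ≤ Lp → (∀ a b : ℤ, -Lp ≤ a → a ≤ Lp → -Lp ≤ b → b ≤ Lp → (((zdShiftIso (-n)).trans (zdSignedPermIso π ε)).symm ![a, b] ∈ meshVertices G.Ω G.δ ↔ (0 ≤ b ∧ (corner = true → 0 ≤ s * a)))) → nA ∈ G.zdArcA → nB ∈ G.zdArcB → (∀ e ∈ G.zdABEdges, e = s(nA, nB) ∨ e = eF) → (∀ x ∈ eF, 4 * (N : ℤ)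 + 2 * h + 2 ≤ |((zdShiftIso (-n)).trans (zdSignedPermIso π ε)) x 0| ∨ 4 * (N : ℤ) + 2 * h + 2 ≤ |((zdShiftIso (-n)).trans (zdSignedPermIso π ε)) x 1|) → (corner = false → nA = ((zdShiftIso (-n)).trans (zdSignedPermIso π ε)).symm ![0, 0] ∧ nB = ((zdShiftIso (-n)).trans (zdSignedPermIso π ε)).symm ![-s, 0]) → (corner = true → 1 ≤ t₀ ∧ t₀ ≤ N ∧ (onA = true → nA = ((zdShiftIso (-n)).trans (zdSignedPermIso π ε)).symm ![0, t₀] ∧ nB = ((zdShiftIso (-n)).trans (zdSignedPermIso π ε)).symm ![0, t₀ - 1]) ∧ (onA = false → nB = ((zdShiftIso (-n)).trans (zdSignedPermIso π ε)).symm ![s * t₀, 0] ∧ nA = ((zdShiftIso (-n)).trans (zdSignedPermIso π ε)).symm ![s * (t₀ - 1), 0])) → (|Site.signedPerm π ε u 0| + 2 ≤ h ∧ |Site.signedPerm π ε u 1| + 2 ≤ h) → ∀ (ω : BondConfig (Site 2)) (v₀ uf g : Site 2) (k₀ : Fin 4) (P : (zdGraph 2).Walk v₀ uf) (Q : (zdGraph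 2).Walk (cFace (v₀, k₀)) g), (∀ e ∈ P.edges, e ∈ BondConfig.relabel (sym2Equiv ((zdShiftIso (-n)).trans (zdSignedPermIso π ε)).toEquiv) ω) → (∀ d ∈ Q.darts, sepEdge d.fst d.snd ∉ BondConfig.relabel (sym2Equiv ((zdShiftIso (-n)).trans (zdSignedPermIso π ε)).toEquiv) ω) → (∀ z ∈ P.support, ∃ z' ∈ ufrsGateRA corner N h, z 0 = s * z' 0 ∧ z 1 = z' 1) → (∃ u' ∈ ufrsGateFA corner N h, uf 0 = s * u' 0 ∧ uf 1 = u' 1) → (∀ f ∈ Q.support, ∃ f' ∈ ufrsGateRB corner N h, 2 * f 0 = 2 * s * f' 0 - (1 - s) ∧ f 1 = f' 1) → (∃ g' ∈ ufrsGateFB corner N h, 2 * g 0 = 2 * s * g' 0 - (1 - s) ∧ g 1 = g' 1) → ∀ (F : DiscreteDobrushin), (F = G ∨ F = shiftData G u) → ∀ (c : Site 2 × Fin 4) (i j' : ℕ), i ≤ j' → (∀ t, i ≤ t → t ≤ j' → F.IsInnerFace (cFace (cornerOrbit (F.bcBondConfig ω) c t))) → ((-(2 * (N : ℤ) - 1)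 ≤ ((cornerOrbit (F.bcBondConfig ω) c i).1 - n) 0 ∧ ((cornerOrbit (F.bcBondConfig ω) c i).1 - n) 0 ≤ 2 * N - 1 ∧ -(2 * (N : ℤ) - 1) ≤ ((cornerOrbit (F.bcBondConfig ω) c i).1 - n) 1 ∧ ((cornerOrbit (F.bcBondConfig ω) c i).1 - n) 1 ≤ 2 * N - 1) ∧ (4 * (N : ℤ) + h + 3 ≤ |((cornerOrbit (F.bcBondConfig ω) c j').1 - n) 0| ∨ 4 * (N : ℤ) + h + 3 ≤ |((cornerOrbit (F.bcBondConfig ω) c j').1 - n) 1|)) ∨ ((4 * (N : ℤ) + h + 3 ≤ |((cornerOrbit (F.bcBondConfig ω) c i).1 - n) 0| ∨ 4 * (N : ℤ) + h + 3 ≤ |((cornerOrbit (F.bcBondConfig ω) c i).1 - n) 1|) ∧ (-(2 * (N : ℤ) - 1) ≤ ((cornerOrbit (F.bcBondConfig ω) c j').1 - n) 0 ∧ ((cornerOrbit (F.bcBondConfig ω) c j').1 - n) 0 ≤ 2 * N - 1 ∧ -(2 * (N : ℤ) - 1) ≤ ((cornerOrbit (F.bcBondConfig ω) c j').1 - n)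 1 ∧ ((cornerOrbit (F.bcBondConfig ω) c j').1 - n) 1 ≤ 2 * N - 1)) → ∃ s', i ≤ s' ∧ s' ≤ j' ∧ cornerOrbit (F.bcBondConfig ω) c s' = (((zdShiftIso (-n)).trans (zdSignedPermIso π ε)).symm v₀, k₀ - j) := by
  intro G a₀ a₁ b₀ b₁ hG hGΩ π ε j n hrot N h s corner onA t₀ Lp nA nB u eF hhN h1 hs hLp hphys hA hB hAB hfar hflat hcor hu
    ω v₀ uf g k₀ P Q hPω hQω hPR huF hQR hgF F hF c i j' hij hin hends
  set Ψ : zdGraph 2 ≃g zdGraph 2 := (zdShiftIso (-n)).trans (zdSignedPermIso π ε) with hΨ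
  -- the reference box of `G`
  obtain ⟨hV, hBd⟩ := box_coords_HJ hGΩ hG
  obtain ⟨I₀, I₁, J₀, J₁, hIJ⟩ := refbox_JF hrot n (⌊a₀ / G.δ⌋ + 1) (⌈a₁ / G.δ⌉ - 1) (⌊b₀ / G.δ⌋ + 1) (⌈b₁ / G.δ⌉ - 1)
  have hboxG : ∀ z : Site 2, Ψ.symm z ∈ meshVertices G.Ω G.δ ↔ (I₀ ≤ z 0 ∧ z 0 ≤ I₁ ∧ J₀ ≤ z 1 ∧ z 1 ≤ J₁) := by
    intro z; rw [hV, (hIJ z).1]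
  have hbdryG : ∀ z : Site 2, Ψ.symm z ∈ G.zdBoundary ↔
      (I₀ ≤ z 0 ∧ z 0 ≤ I₁ ∧ J₀ ≤ z 1 ∧ z 1 ≤ J₁) ∧ (z 0 = I₀ ∨ z 0 = I₁ ∨ z 1 = J₀ ∨ z 1 = J₁) := by
    intro z; rw [hBd, (hIJ z).1, (hIJ z).2]
  -- its position, from the physical geometry at five test points
  have hP := fun a b (ha : -Lp ≤ a) (ha' : a ≤ Lp) (hb : -Lp ≤ b) (hb' : b ≤ Lp) => (hboxG _).symm.trans (hphys a b ha ha' hb hb')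
  have t1 := hP 0 0 (by omega) (by omega) (by omega) (by omega)
  have t2 := hP 0 (-1) (by omega) (by omega) (by omega) (by omega)
  have t3 := hP 0 Lp (by omega) (by omega) (by omega) le_rfl
  have t4 := hP Lp 0 (by omega) le_rfl (by omega) (by omega)
  have t5 := hP (-Lp) 0 le_rfl (by omega) (by omega) (by omega)
  have t6 := hP 1 0 (by omega) (by omega) (by omega) (by omega)
  have t7 := hP (-1) 0 (by omega) (by omega) (by omega) (by omega)
  simp only [Matrix.cons_val_zero, Matrix.cons_val_one] at t1 t2 t3 t4 t5 t6 t7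
  have hJ₀ : J₀ = 0 := by
    cases corner <;> rcases hs with rfl | rfl <;> simp at t1 t2 t3 <;> omega
  have hJ₁ : Lp ≤ J₁ := by
    cases corner <;> rcases hs with rfl | rfl <;> simp at t1 t3 <;> omega
  have hposF : corner = false → I₀ ≤ -Lp ∧ Lp ≤ I₁ := by
    intro hc; subst hc; simp at t4 t5; omega
  have hpos1 : corner = true → s = 1 → I₀ = 0 ∧ Lp ≤ I₁ := by
    intro hc hs1; subst hc; subst hs1; simp at t1 t4 t7; omega
  have hpos2 : corner = true → s = -1 → I₁ = 0 ∧ I₀ ≤ -Lp := by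
    intro hc hs1; subst hc; subst hs1; simp at t1 t5 t6; omega
  -- the colours near the junction
  obtain ⟨hcolF, hcolC⟩ := junction_colours_JF G a₀ a₁ b₀ b₁ hG hGΩ Ψ I₀ I₁ J₀ J₁ (4 * N + 2 * h + 1) s corner onA t₀ nA nB eF
    hbdryG hs hA hB hAB (fun x hx => by have := hfar x hx; omega) (by omega) hJ₀ (by omega)
    (fun hc => ⟨by have := hposF hc; omega, by have := hposF hc; omega, (hflat hc).1, (hflat hc).2⟩)
    (fun hc => ⟨(hcor hc).1, by have := (hcor hc).2.1; omega, fun hs1 => ⟨(hpos1 hc hs1).1, by have := hpos1 hc hs1; omega⟩,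
      fun hs1 => ⟨(hpos2 hc hs1).1, by have := hpos2 hc hs1; omega⟩, (hcor hc).2.2.1, (hcor hc).2.2.2⟩)
  have hdisjA : ∀ x, x ∈ G.zdArcA → x ∉ G.zdArcB := fun x hxA hxB => Set.disjoint_left.1 hG.disjoint hxA hxB
  have hdisjB : ∀ x, x ∈ G.zdArcB → x ∉ G.zdArcA := fun x hxB hxA => Set.disjoint_left.1 hG.disjoint hxA hxB
  have ht₀N : corner = true → t₀ ≤ N := fun hc => (hcor hc).2.1
  rcases hF with rfl | rfl
  · -- the datum itself
    refine datum_funnel_JF _ a₀ a₁ b₀ b₁ hG hGΩ π ε j n hrot N h (by omega) h1 s hs corner I₀ I₁ J₀ J₁ hboxG hbdryG (by omega)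
      (by omega) (fun hc => by have := hposF hc; omega) (fun hc hs1 => by have := hpos1 hc hs1; omega)
      (fun hc hs1 => by have := hpos2 hc hs1; omega) ?_ ?_ ?_ ?_ ?_ ω v₀ uf g k₀ P Q hPω hQω hPR huF hQR hgF c i j' hij hin hends
    · intro hc x hx1 hx2; rw [hJ₀]; exact hdisjA _ ((hcolF hc).1 x (by omega) (by omega))
    · intro hc x hx1 hx2; rw [hJ₀]; exact hdisjB _ ((hcolF hc).2 x (by omega) (by omega))
    · intro hc hs1 y hy1 hy2; rw [(hpos1 hc hs1).1]
      exact hdisjA _ ((hcolC hc).1 y (by have := ht₀N hc; omega) (by omega))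
    · intro hc hs1 y hy1 hy2; rw [(hpos2 hc hs1).1]
      exact hdisjA _ ((hcolC hc).1 y (by have := ht₀N hc; omega) (by omega))
    · intro hc x hx1 hx2; rw [hJ₀]
      exact hdisjB _ ((hcolC hc).2 x (by have := ht₀N hc; omega) (by omega))
  · -- the translate: everything is shifted by `σ u`
    set u' : Site 2 := Site.signedPerm π ε u with hu'
    have hG' : (shiftData G u).IsZdAdmissible := isZdAdmissible_shiftData G u hG
    have hGΩ' : (shiftData G u).Ω = Set.Ioo ((meshPoint G.δ u).re + a₀) ((meshPoint G.δ u).re + a₁) ×ℂ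
        Set.Ioo ((meshPoint G.δ u).im + b₀) ((meshPoint G.δ u).im + b₁) := by
      rw [shiftData_Ω, hGΩ, vadd_rect_ONE]
    have hsub : ∀ z : Site 2, Ψ.symm z - u = Ψ.symm (z - u') := frame_symm_sub_JF π ε n u
    have hV' : ∀ z : Site 2, Ψ.symm z ∈ meshVertices (shiftData G u).Ω (shiftData G u).δ ↔ Ψ.symm (z - u') ∈ meshVertices G.Ω G.δ := by
      intro z
      rw [← meshDomain_eq_rect hG' hGΩ', ← meshDomain_eq_rect hG hGΩ, ← hsub, shiftData_Ω, shiftData_δ, mem_meshDomain_vadd]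
    have hbox' : ∀ z : Site 2, Ψ.symm z ∈ meshVertices (shiftData G u).Ω (shiftData G u).δ ↔
        (I₀ + u' 0 ≤ z 0 ∧ z 0 ≤ I₁ + u' 0 ∧ J₀ + u' 1 ≤ z 1 ∧ z 1 ≤ J₁ + u' 1) := by
      intro z; rw [hV', hboxG]; simp only [Pi.sub_apply]; omega
    have hbdry' : ∀ z : Site 2, Ψ.symm z ∈ (shiftData G u).zdBoundary ↔
        (I₀ + u' 0 ≤ z 0 ∧ z 0 ≤ I₁ + u' 0 ∧ J₀ + u' 1 ≤ z 1 ∧ z 1 ≤ J₁ + u' 1) ∧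
        (z 0 = I₀ + u' 0 ∨ z 0 = I₁ + u' 0 ∨ z 1 = J₀ + u' 1 ∨ z 1 = J₁ + u' 1) := by
      intro z
      rw [show Ψ.symm z = (Ψ.symm z - u) + u by abel, mem_zdBoundary_shiftData_iff, hsub, hbdryG]
      simp only [Pi.sub_apply]; omega
    have hA' : ∀ z : Site 2, Ψ.symm (z - u') ∉ G.zdArcA → Ψ.symm z ∉ (shiftData G u).zdArcA := by
      intro z hz hz'
      rw [show Ψ.symm z = (Ψ.symm z - u) + u by abel, mem_zdArcA_shiftData_iff, hsub] at hz'
      exact hz hz'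
    have hB' : ∀ z : Site 2, Ψ.symm (z - u') ∉ G.zdArcB → Ψ.symm z ∉ (shiftData G u).zdArcB := by
      intro z hz hz'
      rw [show Ψ.symm z = (Ψ.symm z - u) + u by abel, mem_zdArcB_shiftData_iff, hsub] at hz'
      exact hz hz'
    have hu0 := abs_le.1 (show |u' 0| ≤ h - 2 by omega)
    have hu1 := abs_le.1 (show |u' 1| ≤ h - 2 by omega)
    refine datum_funnel_JF _ _ _ _ _ hG' hGΩ' π ε j n hrot N h (by omega) h1 s hs corner (I₀ + u' 0) (I₁ + u' 0)
      (J₀ + u' 1) (J₁ + u' 1) hbox' hbdry' (by omega) (by omega)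
      (fun hc => by have := hposF hc; omega) (fun hc hs1 => by have := hpos1 hc hs1; omega)
      (fun hc hs1 => by have := hpos2 hc hs1; omega) ?_ ?_ ?_ ?_ ?_ ω v₀ uf g k₀ P Q hPω hQω hPR huF hQR hgF c i j' hij hin hends
    · intro hc x hx1 hx2
      refine hB' _ (hdisjA _ ?_)
      rw [vec_sub_JF, hJ₀, show (0 : ℤ) + u' 1 - u' 1 = 0 by ring]
      refine (hcolF hc).1 (x - u' 0) ?_ ?_ <;> rcases hs with rfl | rfl <;> omega
    · intro hc x hx1 hx2
      refine hA' _ (hdisjB _ ?_)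
      rw [vec_sub_JF, hJ₀, show (0 : ℤ) + u' 1 - u' 1 = 0 by ring]
      refine (hcolF hc).2 (x - u' 0) ?_ ?_ <;> rcases hs with rfl | rfl <;> omega
    · intro hc hs1 y hy1 hy2
      refine hB' _ (hdisjA _ ?_)
      rw [vec_sub_JF, (hpos1 hc hs1).1, show (0 : ℤ) + u' 0 - u' 0 = 0 by ring]
      exact (hcolC hc).1 (y - u' 1) (by have := ht₀N hc; omega) (by omega)
    · intro hc hs1 y hy1 hy2
      refine hB' _ (hdisjA _ ?_)
      rw [vec_sub_JF, (hpos2 hc hs1).1, show (0 : ℤ) + u' 0 - u' 0 = 0 by ring]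
      exact (hcolC hc).1 (y - u' 1) (by have := ht₀N hc; omega) (by omega)
    · intro hc x hx1 hx2
      refine hA' _ (hdisjB _ ?_)
      rw [vec_sub_JF, hJ₀, show (0 : ℤ) + u' 1 - u' 1 = 0 by ring]
      refine (hcolC hc).2 (x - u' 0) ?_ ?_ <;> rcases hs with rfl | rfl <;> (have := ht₀N hc; omega)

end

end Summit.CriticalPhenomena.CardyFormulaZ2.Cruxes.EdgePrecompact.QkzStripBoundaryArm
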